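import Summits.CriticalPhenomena.PercolationContinuityZ3.Theorems.PercNearOneGluingNoHeavyLowerTailKNQuestion7AllRelays
import Literature.Probability.Percolation.KozmaNitzanClusterProperty
import HarnessLib

/-!
# Kozma–Nitzan's Question 9 for observers with AT MOST ONE WEAK PORT (contains the setting of their Theorem 5)

Support file (`--supports stmt-CriticalPhenomena-4575`), prover `prim-ineq-gen-6` (gen 11; memo `prim-ineq-gen-6/FINDING-G11.md` §2).
No definitions, no named facts, no sorries; standard axioms.

Kozma–Nitzan (arXiv:2401.12397), Question 9 (p. 36): with `H = G ∖ {edges at 0}` and `c` the minimiser of `P_H(a ↔ b)` over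
`a ∈ A`, is `P(0 ↔ b, 0 ↔ A) ≥ P(0 ↔ A, c ↔ b)` (their (41))?  Printed partial answers: Theorem 4 (p. 12; `0` isolated in
`G ∖ A`) and Theorem 5 (p. 13; `0` joined only to `A ∪ {x}` with `(G ∖ 0, A, x, b)` good).

Decompose along the stars `σ_B` of `0` (`B` = the set of open pairs at `0`).  THREE kinds of stars are harmless for the
`H`-minimiser `c`:
 (i)  `B` containing a relay, or a non-relay port `v` that is STRONG, `P_H(v ↔ b, v ↔ A) ≥ P_H(c ↔ b)`: the cluster-property
      Lemma 5 of the tree (`KozmaNitzan2024_lemma5_cluster`, predicate `b ∈ S ∧ S ∩ A ≠ ∅`) — file `…KNQuestion9StrongPorts`;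
 (ii) NEW HERE — every SINGLETON star `B = {v}`, whatever `v` is: under `σ_{v}` the observer is a leaf hanging at `v`, so the
      star term is `P(σ_{v}) · [P_H(c ↔ b, v ↔ A) − P_H(v ↔ b, v ↔ A)] ≤ 0` by QUESTION 7 / Conjecture 2 in designated form IN
      THE GRAPH `H` with observer `v` (tree theorem `Q7Psi.kn_question7_fintype`, from the conditioned slack hierarchy);
 (iii) null stars (a weight-`0` pair asked to be open) and the empty star (`0 ↮ A`).
Hence (41) holds for the `H`-minimiser as soon as every star with at least two ports contains a relay or a strong port, i.e.
as soon as `0` has AT MOST ONE WEAK PORT (`KNQ9.question9_of_atMostOneWeakPort`); in particular whenever `0` has at most one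
non-relay port (`KNQ9.question9_of_atMostOneNonRelayPort`) — the vertex configuration of Kozma–Nitzan's Theorem 5, here
WITHOUT the goodness hypothesis on `(G ∖ 0, A, x, b)` (Theorem 5's conclusion "good" is a different statement).  What remains
of Question 9 is exactly the stars made of two or more weak ports (cell memo FINDING-G11 §2: 0 violations in 42,617 such stars,
n ≤ 6 exhaustive; Question 9 itself 0 / 12.25·10⁶ through n = 7).
[cite: KozmaNitzan2024, Question 9 (p. 36), Question 7 (p. 36), Thm. 4 (p. 12), Thm. 5 (p. 13), Lemma 5 (p. 13), Thm. 8 (p. 32)]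
-/

noncomputable section

namespace Summit.CriticalPhenomena.PercolationContinuityZ3.Theorems

open MeasureTheory Set Literature.Probability.LatticeModels Literature.Probability.Percolation
open scoped Classical

namespace KNQ9

variable {V : Type*} [Fintype V]

open KNPreFKG in
/-- **A singleton star is controlled by Question 7 in `G ∖ {0}`.**  `0 ∉ A`, `c ∈ A` with
`P_{G∖0}(c ↔ b) ≤ P_{G∖0}(a ↔ b)` for all `a ∈ A`, and ANY vertex `v ≠ 0`.  Then
`P(c ↔ b, 0 ↔ A, σ_{v}) ≤ P(0 ↔ b, 0 ↔ A, σ_{v})`: under `σ_{v}` the observer is a leaf at `v`, an open path between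
vertices `≠ 0` never needs `0` (`walk_decomp`), `{0 ↔ x} = {v ↔ x off 0}`, the star is independent of the pairs off `0`
(`real_starEvent_inter_preimage`), and on `G ∖ {0}` the comparison `P'(c ↔ b, v ↔ A) ≤ P'(v ↔ b, v ↔ A)` is Question 7 with
observer `v` (`Q7Psi.kn_question7_fintype`). [cite: KozmaNitzan2024, Question 7 (p. 36), Question 9 (p. 36), Lemma 5 (p. 13)] -/
theorem singletonStar_le (w : Sym2 V → unitInterval) (A : Finset V) (o b c v : V) (hoA : o ∉ A) (hcA : c ∈ A)
    (hvo : v ≠ o)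
    (hcmin : ∀ a ∈ A, (prodBernoulli w).real (openConnIn ({o}ᶜ : Set V) c b) ≤
      (prodBernoulli w).real (openConnIn ({o}ᶜ : Set V) a b)) :
    (prodBernoulli w).real ((openConn c b ∩ ⋃ a' ∈ A, openConn o a') ∩ starEvent o ({v} : Set V)) ≤
      (prodBernoulli w).real ((openConn o b ∩ ⋃ a' ∈ A, openConn o a') ∩ starEvent o ({v} : Set V)) := by
  classical
  set μ := prodBernoulli w with hμ
  have hco : c ≠ o := fun h => hoA (h ▸ hcA)
  -- the degenerate case `b = 0`
  by_cases hbo : b = o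
  · subst hbo
    exact measureReal_mono fun ω ⟨⟨_, hU⟩, hσ⟩ => ⟨⟨SimpleGraph.Reachable.refl _, hU⟩, hσ⟩
  -- the graph `G ∖ {0}`
  set S : Set V := {o}ᶜ with hS
  haveI : Fintype S := Fintype.ofFinite S
  set f : S → V := Subtype.val with hf
  set w' : Sym2 S → unitInterval := w ∘ Sym2.map f with hw'
  set μ' := prodBernoulli w' with hμ'
  have hcS : c ∈ S := mem_compl_singleton_iff.2 hco
  have hvS : v ∈ S := mem_compl_singleton_iff.2 hvo
  have hbS : b ∈ S := mem_compl_singleton_iff.2 hbo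
  set c' : S := ⟨c, hcS⟩ with hc'
  set v' : S := ⟨v, hvS⟩ with hv'
  set b' : S := ⟨b, hbS⟩ with hb'
  set A' : Finset S := A.subtype (· ∈ S) with hA'
  have hc'A' : c' ∈ A' := by rw [hA', Finset.mem_subtype]; exact hcA
  -- the minimality of `c`, read on `G ∖ {0}`
  have hcmin' : ∀ a ∈ A', μ'.real (openConn c' b') ≤ μ'.real (openConn a b') := by
    intro a ha
    rw [hA', Finset.mem_subtype] at ha
    have e1 : μ'.real (openConn c' b') = μ.real (openConnIn S c b) := by
      rw [hμ', hw', hf, ← real_preimage_restrictConfig_val, preimage_openConn_val]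
    have e2 : μ'.real (openConn a b') = μ.real (openConnIn S a b) := by
      rw [hμ', hw', hf, ← real_preimage_restrictConfig_val]
      exact congrArg μ.real (preimage_openConn_val S a.2 hbS)
    rw [e1, e2]
    exact hcmin a ha
  -- Question 7 on `G ∖ {0}` with observer `v`
  have Q7 := Q7Psi.kn_question7_fintype w' A' v' b' c' hc'A' hcmin'
  set X : Set (BondConfig S) := openConn c' b' ∩ ⋃ a ∈ A', openConn v' a with hX
  set Z : Set (BondConfig S) := openConn v' b' ∩ ⋃ a ∈ A', openConn v' a with hZ
  have hXZ : μ.real (restrictConfig f ⁻¹' X) ≤ μ.real (restrictConfig f ⁻¹' Z) := by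
    rw [hf, real_preimage_restrictConfig_val, real_preimage_restrictConfig_val]
    exact Q7
  set σ : Set (BondConfig V) := starEvent o ({v} : Set V) with hσdef
  -- `{c ↔ b, 0 ↔ A} ∩ σ ⊆ σ ∩ pull-back of X`
  have hsub1 : (openConn c b ∩ ⋃ a' ∈ A, openConn o a') ∩ σ ⊆ σ ∩ restrictConfig f ⁻¹' X := by
    rintro ω ⟨⟨hcb, hU⟩, hσ⟩
    refine ⟨hσ, ?_⟩
    rw [mem_preimage]
    refine ⟨?_, ?_⟩
    · -- `c ↔ b` off `0`
      obtain ⟨p⟩ := (hcb : (openGraph ω).Reachable c b)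
      change (openGraph (restrictConfig Subtype.val ω)).Reachable c' b'
      refine (reachable_restrictConfig_val_iff S ω c' b').2 ?_
      rcases (walk_decomp hσ p hbo).1 hco with h | ⟨⟨u, huB, _, hcu⟩, ⟨u', hu'B, _, hu'b⟩⟩
      · exact h
      · rw [mem_singleton_iff] at huB hu'B
        subst huB; subst hu'B
        exact openConnIn_trans hcu hu'b
    · -- `v ↔ a₀` off `0` for the relay `a₀` joined to `0`
      obtain ⟨a₀, ha₀, hoa₀⟩ := mem_iUnion₂.1 hU
      have ha₀o : a₀ ≠ o := fun h => hoA (h ▸ ha₀)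
      obtain ⟨p⟩ := (hoa₀ : (openGraph ω).Reachable o a₀)
      obtain ⟨u', hu'B, _, hu'a⟩ := (walk_decomp hσ p ha₀o).2 rfl
      rw [mem_singleton_iff] at hu'B
      subst hu'B
      have ha₀S : a₀ ∈ S := mem_compl_singleton_iff.2 ha₀o
      refine mem_iUnion₂.2 ⟨⟨a₀, ha₀S⟩, by rw [hA', Finset.mem_subtype]; exact ha₀, ?_⟩
      change (openGraph (restrictConfig Subtype.val ω)).Reachable v' ⟨a₀, ha₀S⟩
      exact (reachable_restrictConfig_val_iff S ω v' ⟨a₀, ha₀S⟩).2 hu'a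
  -- `σ ∩ pull-back of Z ⊆ {0 ↔ b, 0 ↔ A} ∩ σ`
  have hsub2 : σ ∩ restrictConfig f ⁻¹' Z ⊆ (openConn o b ∩ ⋃ a' ∈ A, openConn o a') ∩ σ := by
    rintro ω ⟨hσ, hvb, hUv⟩
    have hov : s(o, v) ∈ ω := ((mem_starEvent_iff o {v} ω).1 hσ v hvo).2 (mem_singleton v)
    have hadj : (openGraph ω).Adj o v := (openGraph_adj ω o v).2 ⟨hov, hvo.symm⟩
    refine ⟨⟨?_, ?_⟩, hσ⟩
    · have hvb' : (openGraph ω).Reachable v b :=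
        KNPreFKG.reachable_of_openConnIn ((reachable_restrictConfig_val_iff S ω v' b').1 hvb)
      exact hadj.reachable.trans hvb'
    · obtain ⟨a, haA', hva⟩ := mem_iUnion₂.1 hUv
      rw [hA', Finset.mem_subtype] at haA'
      have hva' : (openGraph ω).Reachable v (a : V) :=
        KNPreFKG.reachable_of_openConnIn ((reachable_restrictConfig_val_iff S ω v' a).1 hva)
      exact mem_iUnion₂.2 ⟨(a : V), haA', hadj.reachable.trans hva'⟩
  -- assemble with the independence of `σ` from the pairs off `0`
  calc μ.real ((openConn c b ∩ ⋃ a' ∈ A, openConn o a') ∩ σ)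
      ≤ μ.real (σ ∩ restrictConfig f ⁻¹' X) := measureReal_mono hsub1
    _ = μ.real σ * μ.real (restrictConfig f ⁻¹' X) := real_starEvent_inter_preimage w o {v} _
    _ ≤ μ.real σ * μ.real (restrictConfig f ⁻¹' Z) := mul_le_mul_of_nonneg_left hXZ measureReal_nonneg
    _ = μ.real (σ ∩ restrictConfig f ⁻¹' Z) := (real_starEvent_inter_preimage w o {v} _).symm
    _ ≤ μ.real ((openConn o b ∩ ⋃ a' ∈ A, openConn o a') ∩ σ) := measureReal_mono hsub2

open KNPreFKG in
/-- **A star containing a relay or a strong port is controlled by the cluster-property Lemma 5.**  `0 ∉ A`, `c ∈ A` with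
`P_{G∖0}(c ↔ b) ≤ P_{G∖0}(a ↔ b)` for all `a ∈ A`; `v ∈ B`, `v ≠ 0`, and either `v ∈ A` or `v` strong:
`P_{G∖0}(c ↔ b) ≤ P_{G∖0}(v ↔ b, v ↔ A)`.  Then `P(c ↔ b, 0 ↔ A, σ_B) ≤ P(0 ↔ b, 0 ↔ A, σ_B)`
(`KozmaNitzan2024_lemma5_cluster` for the monotone predicate `S ↦ b ∈ S ∧ (∃ a ∈ A, a ∈ S)`).
[cite: KozmaNitzan2024, Lemma 5 (p. 13), Thm. 8 (p. 32), Question 9 (p. 36)] -/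
theorem strongStar_le (w : Sym2 V → unitInterval) (A : Finset V) (o b c v : V) (B : Finset V)
    (hoA : o ∉ A) (hcA : c ∈ A) (hvo : v ≠ o) (hvB : v ∈ B)
    (hcmin : ∀ a ∈ A, (prodBernoulli w).real (openConnIn ({o}ᶜ : Set V) c b) ≤
      (prodBernoulli w).real (openConnIn ({o}ᶜ : Set V) a b))
    (hv : v ∈ A ∨ (prodBernoulli w).real (openConnIn ({o}ᶜ : Set V) c b) ≤
      (prodBernoulli w).real (openConnIn ({o}ᶜ : Set V) v b ∩ ⋃ a ∈ A, openConnIn ({o}ᶜ : Set V) v a)) :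
    (prodBernoulli w).real ((openConn c b ∩ ⋃ a' ∈ A, openConn o a') ∩ starEvent o (↑B : Set V)) ≤
      (prodBernoulli w).real ((openConn o b ∩ ⋃ a' ∈ A, openConn o a') ∩ starEvent o (↑B : Set V)) := by
  classical
  set μ := prodBernoulli w with hμ
  have hco : c ≠ o := fun h => hoA (h ▸ hcA)
  set P : Set V → Prop := fun S => b ∈ S ∧ ∃ a ∈ A, a ∈ S with hPdef
  have hP : ∀ S T : Set V, S ⊆ T → P S → P T := by
    rintro S T hST ⟨hb, a, ha, haS⟩
    exact ⟨hST hb, a, ha, hST haS⟩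
  have hPc : {ω : BondConfig V | P (openCluster ω c)} = openConn c b := by
    ext ω
    simp only [mem_setOf_eq, hPdef]
    constructor
    · rintro ⟨hb, -⟩; exact hb
    · intro hb; exact ⟨hb, c, hcA, mem_openCluster_self ω c⟩
  have hPo : {ω : BondConfig V | P (openCluster ω o)} = openConn o b ∩ ⋃ a' ∈ A, openConn o a' := by
    ext ω
    simp only [mem_setOf_eq, hPdef, mem_inter_iff, mem_iUnion, exists_prop]
    rfl
  have hPc' : {ω : BondConfig V | P {y | ω ∈ openConnIn ({o}ᶜ : Set V) c y}} = openConnIn ({o}ᶜ : Set V) c b := by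
    ext ω
    simp only [mem_setOf_eq, hPdef]
    constructor
    · rintro ⟨hb, -⟩; exact hb
    · intro hb
      refine ⟨hb, c, hcA, ?_⟩
      show ω ∈ openConnIn ({o}ᶜ : Set V) c c
      exact ⟨hco, hco, SimpleGraph.Reachable.refl _⟩
  have hPv' : {ω : BondConfig V | P {y | ω ∈ openConnIn ({o}ᶜ : Set V) v y}} =
      openConnIn ({o}ᶜ : Set V) v b ∩ ⋃ a ∈ A, openConnIn ({o}ᶜ : Set V) v a := by
    ext ω
    simp only [mem_setOf_eq, hPdef, mem_inter_iff, mem_iUnion, exists_prop]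
  have hyp : μ.real {ω : BondConfig V | P {y | ω ∈ openConnIn ({o}ᶜ : Set V) c y}} ≤
      μ.real {ω : BondConfig V | P {y | ω ∈ openConnIn ({o}ᶜ : Set V) v y}} := by
    rw [hPc', hPv']
    rcases hv with hvA | hstrong
    · refine (hcmin v hvA).trans (measureReal_mono fun ω hω => ⟨hω, ?_⟩)
      exact mem_iUnion₂.2 ⟨v, hvA, ⟨hvo, hvo, SimpleGraph.Reachable.refl _⟩⟩
    · exact hstrong
  have L5 := KozmaNitzan2024_lemma5_cluster w o c v (↑B) P hP hco hvo (Finset.mem_coe.2 hvB) hyp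
  rw [hPc, hPo] at L5
  calc μ.real ((openConn c b ∩ ⋃ a' ∈ A, openConn o a') ∩ starEvent o ↑B)
      ≤ μ.real (openConn c b ∩ starEvent o ↑B) :=
        measureReal_mono fun ω ⟨⟨h1, _⟩, h2⟩ => ⟨h1, h2⟩
    _ ≤ μ.real ((openConn o b ∩ ⋃ a' ∈ A, openConn o a') ∩ starEvent o ↑B) := L5

open KNPreFKG in
/-- **Kozma–Nitzan's Question 9 holds for every observer with AT MOST ONE WEAK PORT.**  `0 ∉ A`; `c ∈ A` ANY minimiser of
`P_{G∖0}(· ↔ b)` over `A` (ties allowed); call a vertex `p ∉ A`, `p ≠ 0`, with `w s(0,p) ≠ 0` a non-relay PORT of `0`, and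
call it STRONG if `P_{G∖0}(c ↔ b) ≤ P_{G∖0}(p ↔ b, p ↔ A)`.  If among any two distinct non-relay ports at least one is strong
(i.e. `0` has at most one weak port), then `P(0 ↔ A, c ↔ b) ≤ P(0 ↔ b, 0 ↔ A)` — inequality (41) for the designation of
Question 9.  Proof: star decomposition (`real_eq_sum_inter_starEvent` over all stars of `0`); stars with a relay or a strong
port by `strongStar_le`, singleton stars by `singletonStar_le` (Question 7 in `G ∖ 0`), stars asking a weight-`0` pair to be
open are null, the empty star forces `0 ↮ A`; a star of ≥ 2 ports without relays contains a strong port by hypothesis.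
[cite: KozmaNitzan2024, Question 9 (p. 36), Question 7 (p. 36), Thm. 4 (p. 12), Thm. 5 (p. 13), Lemma 5 (p. 13)] -/
theorem question9_of_atMostOneWeakPort (w : Sym2 V → unitInterval) (A : Finset V) (o b c : V)
    (hoA : o ∉ A) (hcA : c ∈ A)
    (hcmin : ∀ a ∈ A, (prodBernoulli w).real (openConnIn ({o}ᶜ : Set V) c b) ≤
      (prodBernoulli w).real (openConnIn ({o}ᶜ : Set V) a b))
    (hweak : ∀ p q : V, p ≠ q → p ∉ A → q ∉ A → p ≠ o → q ≠ o → w s(o, p) ≠ 0 → w s(o, q) ≠ 0 →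
      (prodBernoulli w).real (openConnIn ({o}ᶜ : Set V) c b) ≤
          (prodBernoulli w).real (openConnIn ({o}ᶜ : Set V) p b ∩ ⋃ a ∈ A, openConnIn ({o}ᶜ : Set V) p a) ∨
        (prodBernoulli w).real (openConnIn ({o}ᶜ : Set V) c b) ≤
          (prodBernoulli w).real (openConnIn ({o}ᶜ : Set V) q b ∩ ⋃ a ∈ A, openConnIn ({o}ᶜ : Set V) q a)) :
    (prodBernoulli w).real (openConn c b ∩ ⋃ a' ∈ A, openConn o a') ≤
      (prodBernoulli w).real (openConn o b ∩ ⋃ a' ∈ A, openConn o a') := by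
  classical
  set μ := prodBernoulli w with hμ
  -- the stars of `o` over ALL other vertices partition the space
  set N : Finset V := Finset.univ.erase o with hN
  have hoN : o ∉ N := Finset.notMem_erase o _
  have hisoN : ∀ u, u ≠ o → u ∉ N → w s(o, u) = 0 := fun u huo huN =>
    absurd (Finset.mem_erase.2 ⟨huo, Finset.mem_univ u⟩) huN
  rw [real_eq_sum_inter_starEvent w N o hoN hisoN (openConn c b ∩ _),
    real_eq_sum_inter_starEvent w N o hoN hisoN (openConn o b ∩ _)]
  refine Finset.sum_le_sum fun B hB => ?_
  have hBo : ∀ u ∈ B, u ≠ o := fun u hu => (Finset.mem_erase.1 (Finset.mem_powerset.1 hB hu)).1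
  rcases B.eq_empty_or_nonempty with rfl | hBne
  · -- under `σ_∅` the observer is isolated, so `0 ↮ A`
    have h0 : (openConn c b ∩ ⋃ a' ∈ A, openConn o a') ∩ starEvent o ↑(∅ : Finset V) =
        (∅ : Set (BondConfig V)) := by
      ext ω
      simp only [mem_inter_iff, mem_iUnion, exists_prop, mem_empty_iff_false, iff_false, not_and]
      rintro ⟨-, a', ha', hoa'⟩ hσ
      rw [Finset.coe_empty] at hσ
      exact not_reachable_of_mem_starEvent_empty hσ (fun h => hoA (h ▸ ha')) hoa'
    rw [h0, measureReal_empty]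
    exact measureReal_nonneg
  · by_cases hnull : ∃ u ∈ B, w s(o, u) = 0
    · -- the star asks a weight-`0` pair to be open: a null event
      obtain ⟨u, hu, hwu⟩ := hnull
      have hnull' : μ.real (starEvent o (↑B : Set V)) = 0 := by
        refine le_antisymm ?_ measureReal_nonneg
        calc μ.real (starEvent o (↑B : Set V))
            ≤ μ.real {ω : BondConfig V | s(o, u) ∈ ω} := measureReal_mono fun ω hσ =>
                ((mem_starEvent_iff o (↑B) ω).1 hσ u (hBo u hu)).2 (Finset.mem_coe.2 hu)
          _ = 0 := by
                rw [hμ, prodBernoulli_real_setOf_mem, hwu]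
                rfl
      have h0 : μ.real ((openConn c b ∩ ⋃ a' ∈ A, openConn o a') ∩ starEvent o ↑B) = 0 :=
        le_antisymm ((measureReal_mono inter_subset_right).trans hnull'.le) measureReal_nonneg
      rw [h0]
      exact measureReal_nonneg
    · push Not at hnull
      -- every vertex of `B` is a port
      by_cases hgood : ∃ v ∈ B, v ∈ A ∨ μ.real (openConnIn ({o}ᶜ : Set V) c b) ≤
          μ.real (openConnIn ({o}ᶜ : Set V) v b ∩ ⋃ a ∈ A, openConnIn ({o}ᶜ : Set V) v a)
      · obtain ⟨v, hvB, hv⟩ := hgood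
        exact strongStar_le w A o b c v B hoA hcA (hBo v hvB) hvB hcmin hv
      · -- all ports of `B` are weak non-relay ports: by hypothesis `B` is a singleton
        push Not at hgood
        obtain ⟨v, hvB⟩ := hBne
        have hB1 : B = {v} := by
          refine Finset.eq_singleton_iff_unique_mem.2 ⟨hvB, fun q hq => ?_⟩
          by_contra hqv
          obtain ⟨hqA, hqweak⟩ := hgood q hq
          obtain ⟨hvA, hvweak⟩ := hgood v hvB
          rcases hweak q v hqv hqA hvA (hBo q hq) (hBo v hvB) (hnull q hq) (hnull v hvB) with h | h
          · exact absurd h (not_le.2 hqweak)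
          · exact absurd h (not_le.2 hvweak)
        rw [hB1, Finset.coe_singleton]
        exact singletonStar_le w A o b c v hoA hcA (hBo v hvB) hcmin

/-- **Question 9 for observers with at most one non-relay port** — the vertex configuration of Kozma–Nitzan's Theorem 5
(`0` joined only to `A ∪ {x}`), with NO goodness hypothesis: if every port of `0` outside `A` equals `x`, then for ANY
minimiser `c` of `P_{G∖0}(· ↔ b)` over `A`, `P(0 ↔ A, c ↔ b) ≤ P(0 ↔ b, 0 ↔ A)`.
[cite: KozmaNitzan2024, Question 9 (p. 36), Thm. 5 (p. 13)] -/
theorem question9_of_atMostOneNonRelayPort (w : Sym2 V → unitInterval) (A : Finset V) (o b c x : V)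
    (hoA : o ∉ A) (hcA : c ∈ A)
    (hcmin : ∀ a ∈ A, (prodBernoulli w).real (openConnIn ({o}ᶜ : Set V) c b) ≤
      (prodBernoulli w).real (openConnIn ({o}ᶜ : Set V) a b))
    (hx : ∀ p : V, p ≠ o → p ∉ A → w s(o, p) ≠ 0 → p = x) :
    (prodBernoulli w).real (openConn c b ∩ ⋃ a' ∈ A, openConn o a') ≤
      (prodBernoulli w).real (openConn o b ∩ ⋃ a' ∈ A, openConn o a') := by
  refine question9_of_atMostOneWeakPort w A o b c hoA hcA hcmin ?_
  intro p q hpq hpA hqA hpo hqo hwp hwq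
  exact absurd ((hx p hpo hpA hwp).trans (hx q hqo hqA hwq).symm) hpq

end KNQ9

end Summit.CriticalPhenomena.PercolationContinuityZ3.Theorems

end
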